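import Literature.Probability.RandomPlanarGeometry.HexSAWSurfaceYcLimitAllY
import Mathlib.Analysis.MeanInequalities
import Mathlib.Analysis.Convex.Deriv

/-!
# Honeycomb SAW at a surface — riders to Proposition 5: `√y ≤ μ(y) ≤ μ√y`, full log-convexity, surface density

Topic `Literature/Probability/RandomPlanarGeometry` (lane pcv-sawmu, door S1; ONE rider file after
`HexSAWSurfaceYcLimitAllY` = Part II, merging a-idea-1 g21's addenda 1 and 2; bytes of record of Part II untouched).

§A (parity, `y ≥ 1`).  In the Duminil-Copin–Smirnov frame surface vertices occur at EVEN times only, so a walk with `n`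
visited vertices has at most `(n+1)/2` surface vertices (`botContacts_le_half`, sharp on T5's zig-zag); hence
`C_n(y) ≤ y^{(n+1)/2} C_n(1)` and **`surfaceMu_le_sqrt_mul : 1 ≤ y → μ(y) ≤ √y · μ`**, the upper companion of
`sqrt_le_surfaceMu : √y ≤ μ(y)`: on the honeycomb lattice `μ(y)` is of ORDER `√y` (BBdGDCG14, remark after Prop. 5, arXiv v5
p. 9: "This translates into μ(y) ∼ √y in our honeycomb setting" — there an unproved translation of Rychlewski–Whittington's
square-lattice asymptotics; here only the two-sided order bound).

§B (Hölder).  Part II proves the midpoint form of log-convexity (`surfaceMu_sqrt_mul_sq_le`); here the FULL statement of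
Proposition 5, "log-convex … function of log y", as a Mathlib `ConvexOn`:
`hpCoeff_rpow_mul_rpow_le` (`C_n(y₁^θ y₂^{1-θ}) ≤ C_n(y₁)^θ C_n(y₂)^{1-θ}`), `surfaceMu_rpow_mul_rpow_le`,
**`convexOn_log_surfaceMu_exp : ConvexOn ℝ univ (fun t ↦ log μ(eᵗ))`**.

§C (surface density `y ∂ log μ(y)/∂y`, remark after Prop. 5, v5 p. 9: "the density of vertices on the surface is 0 for
y < y_c and is positive for y > y_c"), for the limit object wherever `μ'(y)` exists (a.e., `ae_differentiableAt_surfaceMu`):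
**`hasDerivAt_surfaceMu_zero`** (`0 < y < 1+√2 ⇒ μ'(y) = 0`) and **`deriv_surfaceMu_pos`** (`y > 1+√2 ⇒ μ'(y) > 0`, from
convexity: the secant of `log μ ∘ exp` from `log y_c` has positive slope and lies below the tangent).  The exchange of
`lim_n` and `∂_y` (the paper's footnote) is not claimed.

Sources. N. R. Beaton, M. Bousquet-Mélou, J. de Gier, H. Duminil-Copin, A. J. Guttmann, CMP 326 (2014) 727–754, §3.1, Proposition 5
and the remark following its proof (arXiv:1109.0358v5 p. 9); J. M. Hammersley, G. M. Torrie, S. G. Whittington, J. Phys. A 15 (1982)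
539, §2.
-/

noncomputable section

open Finset Filter Function
open Literature.Probability.LatticeModels Literature.Probability.Percolation SimpleGraph
open _root_.Topology

namespace Literature.Probability.RandomPlanarGeometry.SAW.HexBW.Wall

/-- Parity: visits happen at even times only, so `visits n ω ≤ n/2`. [folklore]
[cite: BeatonBousquetMelouDeGierDuminilCopinGuttmann2014, §3.1, set-up of Proposition 5 (arXiv v5 p. 9: weight `y` per vertex in the surface); parity bookkeeping of the lane's brick-wall embedding, not in print] -/
theorem visits_le_half (n : ℕ) (ω : ℕ → Site 2) : visits n ω ≤ n / 2 := by
  induction n with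
  | zero => simp
  | succ n ih => rw [visits_succ]; split_ifs with h <;> omega

end Literature.Probability.RandomPlanarGeometry.SAW.HexBW.Wall

namespace Literature.Probability.RandomPlanarGeometry.SAW.HV

open Literature.Probability.RandomPlanarGeometry.SAW.HexBW.Wall

variable {y : ℝ}

/-- **Parity bound: a mid-edge walk with `n` visited vertices has at most `(n+1)/2` surface vertices** (sharp: T5's zig-zag).
[cite: BeatonBousquetMelouDeGierDuminilCopinGuttmann2014, §3.1, proof of Proposition 5 (arXiv v5 p. 9: "zig-zag walks sticking to the surface")] -/
theorem botContacts_le_half {n : ℕ} {P : List HV} (hP : P ∈ (midWalks (stripV n n)).filter (fun P => mwLen P = n)) :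
    botContacts P ≤ (n + 1) / 2 := by
  rcases n with _ | m
  · have h := Finset.mem_filter.1 hP
    have hc := (mem_midWalks_iff.1 h.1).botContacts_le_mwLen
    omega
  · have hP' : P ∈ fib m := hP
    rw [botContacts_eq_visits hP']
    have hv := visits_le_half m (toWall m P)
    omega

/-- **`C_n(y) ≤ y^{(n+1)/2} · C_n(1)` for `y ≥ 1`.** [cite: HammersleyTorrieWhittington1982, §2] -/
theorem hpCoeff_le_pow_half_mul (hy : 1 ≤ y) (n : ℕ) : hpCoeff n y ≤ y ^ ((n + 1) / 2) * hpCoeff n 1 := by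
  unfold hpCoeff
  rw [Finset.mul_sum]
  refine Finset.sum_le_sum fun P hP => ?_
  rw [one_pow, mul_one]
  exact pow_le_pow_right₀ hy (botContacts_le_half hP)

/-- For `y ≥ 1` and `r > √y·μ`, eventually `C_n(y) ≤ rⁿ`. [cite: HammersleyTorrieWhittington1982, §2; BeatonBousquetMelouDeGierDuminilCopinGuttmann2014, §3.1, Proposition 5 (arXiv v5 p. 9)] -/
theorem eventually_hpCoeff_le_pow_of_sqrt (hy : 1 ≤ y) {r : ℝ} (hr : Real.sqrt y * hexConnectiveConstant < r) :
    ∀ᶠ n : ℕ in atTop, hpCoeff n y ≤ r ^ n := by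
  have hy0 : 0 < y := one_pos.trans_le hy
  have hs1 : 1 ≤ Real.sqrt y := by rw [← Real.sqrt_one]; exact Real.sqrt_le_sqrt hy
  have hs : 0 < Real.sqrt y := one_pos.trans_le hs1
  have hμ1 : surfaceMu 1 = hexConnectiveConstant :=
    (surfaceMu_eq_iff one_pos).2 (by nlinarith [Real.sqrt_nonneg 2])
  have hdiv : hexConnectiveConstant < r / Real.sqrt y := by rw [lt_div_iff₀ hs, mul_comm]; exact hr
  obtain ⟨ρ, hμρ, hρr⟩ := exists_between hdiv
  have hρ0 : 0 < ρ := hexConnectiveConstant_pos.trans hμρ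
  have hq : Real.sqrt y * ρ < r := by rw [lt_div_iff₀ hs, mul_comm] at hρr; exact hρr
  have hq0 : 0 < Real.sqrt y * ρ := mul_pos hs hρ0
  have h1 : ∀ᶠ n : ℕ in atTop, hpCoeff n 1 ≤ ρ ^ n := eventually_hpCoeff_le_pow one_pos (by rw [hμ1]; exact hμρ)
  have h2 : ∀ᶠ n : ℕ in atTop, Real.sqrt y ≤ (r / (Real.sqrt y * ρ)) ^ n :=
    (tendsto_pow_atTop_atTop_of_one_lt ((one_lt_div hq0).2 hq)).eventually_ge_atTop _
  filter_upwards [h1, h2] with n hn1 hn2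
  have e : Real.sqrt y ^ (n + 1) = y ^ ((n + 1) / 2) * Real.sqrt y ^ ((n + 1) % 2) := by
    conv_lhs => rw [← Nat.div_add_mod (n + 1) 2]
    rw [pow_add, pow_mul, Real.sq_sqrt hy0.le]
  have hyk : y ^ ((n + 1) / 2) ≤ Real.sqrt y ^ (n + 1) := by
    rw [e]; exact le_mul_of_one_le_right (pow_nonneg hy0.le _) (one_le_pow₀ hs1)
  calc hpCoeff n y ≤ y ^ ((n + 1) / 2) * hpCoeff n 1 := hpCoeff_le_pow_half_mul hy n
    _ ≤ Real.sqrt y ^ (n + 1) * ρ ^ n := mul_le_mul hyk hn1 (hpCoeff_nonneg n zero_le_one) (pow_nonneg hs.le _)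
    _ = Real.sqrt y * (Real.sqrt y * ρ) ^ n := by rw [pow_succ, mul_pow]; ring
    _ ≤ (r / (Real.sqrt y * ρ)) ^ n * (Real.sqrt y * ρ) ^ n := mul_le_mul_of_nonneg_right hn2 (pow_nonneg hq0.le n)
    _ = r ^ n := by rw [← mul_pow, div_mul_cancel₀ r hq0.ne']

/-- **`μ(y) ≤ √y · μ` for `y ≥ 1`.** [cite: BeatonBousquetMelouDeGierDuminilCopinGuttmann2014, §3.1, remark after Proposition 5 (arXiv v5 p. 9: "translates into μ(y) ∼ √y in our honeycomb setting"); HammersleyTorrieWhittington1982, §2] -/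
theorem surfaceMu_le_sqrt_mul (hy : 1 ≤ y) : surfaceMu y ≤ Real.sqrt y * hexConnectiveConstant := by
  have hy0 : 0 < y := one_pos.trans_le hy
  refine le_of_forall_gt_imp_ge_of_dense fun r hr => ?_
  have hr0 : 0 ≤ r := ((mul_pos (Real.sqrt_pos.2 hy0) hexConnectiveConstant_pos).trans hr).le
  refine le_of_tendsto (tendsto_hpCoeff_rpow hy0) ?_
  filter_upwards [eventually_hpCoeff_le_pow_of_sqrt hy hr, eventually_ne_atTop 0] with n hn hn0
  calc hpCoeff n y ^ ((n : ℝ)⁻¹) ≤ (r ^ n) ^ ((n : ℝ)⁻¹) :=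
        Real.rpow_le_rpow (hpCoeff_nonneg n hy0.le) hn (inv_nonneg.2 (Nat.cast_nonneg n))
    _ = r := Real.pow_rpow_inv_natCast hr0 hn0

/-- **`√y ≤ μ(y) ≤ μ·√y` for `y ≥ 1`: on the honeycomb lattice `μ(y)` is of order `√y`.**
[cite: BeatonBousquetMelouDeGierDuminilCopinGuttmann2014, §3.1, Proposition 5 and the following remark (arXiv v5 p. 9)] -/
theorem sqrt_le_surfaceMu_le (hy : 1 ≤ y) :
    Real.sqrt y ≤ surfaceMu y ∧ surfaceMu y ≤ Real.sqrt y * hexConnectiveConstant :=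
  ⟨sqrt_le_surfaceMu (one_pos.trans_le hy), surfaceMu_le_sqrt_mul hy⟩

/-- In particular the wall-bridge rate is of order `√y` too: **`β(y) ≤ μ·√y`** (`y ≥ 1`). [cite: HammersleyTorrieWhittington1982, §2] -/
theorem wallRate_le_sqrt_mul (hy : 1 ≤ y) : wallRate y ≤ Real.sqrt y * hexConnectiveConstant :=
  (wallRate_le_surfaceMu y).trans (surfaceMu_le_sqrt_mul hy)

end Literature.Probability.RandomPlanarGeometry.SAW.HV


namespace Literature.Probability.RandomPlanarGeometry.SAW.HV

open Literature.Probability.RandomPlanarGeometry.SAW.HexBW.Wall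

variable {y y₁ y₂ θ : ℝ}

/-- **Hölder on the surface partition function:** `C_n(y₁^θ y₂^{1-θ}) ≤ C_n(y₁)^θ · C_n(y₂)^{1-θ}` for `0 < θ < 1`.
[cite: HammersleyTorrieWhittington1982, §2 (log-convexity via Hölder); BeatonBousquetMelouDeGierDuminilCopinGuttmann2014, §3.1, Proposition 5] -/
theorem hpCoeff_rpow_mul_rpow_le (hy₁ : 0 < y₁) (hy₂ : 0 < y₂) (hθ0 : 0 < θ) (hθ1 : θ < 1) (n : ℕ) :
    hpCoeff n (y₁ ^ θ * y₂ ^ (1 - θ)) ≤ hpCoeff n y₁ ^ θ * hpCoeff n y₂ ^ (1 - θ) := by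
  classical
  have hpq : θ⁻¹.HolderConjugate (1 - θ)⁻¹ := Real.HolderConjugate.inv_one_sub_inv hθ0 hθ1
  have h1θ : 0 < 1 - θ := sub_pos.2 hθ1
  unfold hpCoeff
  have key := Real.inner_le_Lp_mul_Lq_of_nonneg ((midWalks (stripV n n)).filter (fun P => mwLen P = n)) hpq
      (f := fun P => (y₁ ^ botContacts P) ^ θ) (g := fun P => (y₂ ^ botContacts P) ^ (1 - θ))
      (fun P _ => by positivity) (fun P _ => by positivity)
  have hf : ∀ P : List HV, ((y₁ ^ botContacts P) ^ θ) ^ θ⁻¹ = y₁ ^ botContacts P := fun P =>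
    Real.rpow_rpow_inv (pow_nonneg hy₁.le _) hθ0.ne'
  have hg : ∀ P : List HV, ((y₂ ^ botContacts P) ^ (1 - θ)) ^ (1 - θ)⁻¹ = y₂ ^ botContacts P := fun P =>
    Real.rpow_rpow_inv (pow_nonneg hy₂.le _) h1θ.ne'
  have hfg : ∀ P : List HV, (y₁ ^ botContacts P) ^ θ * (y₂ ^ botContacts P) ^ (1 - θ) =
      (y₁ ^ θ * y₂ ^ (1 - θ)) ^ botContacts P := fun P => by
    rw [mul_pow, Real.rpow_pow_comm hy₁.le, Real.rpow_pow_comm hy₂.le]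
  simp only [one_div, inv_inv, hf, hg, hfg] at key
  exact key

/-- **`μ(y₁^θ y₂^{1-θ}) ≤ μ(y₁)^θ μ(y₂)^{1-θ}`** (`0 ≤ θ ≤ 1`): log-convexity of `μ` in `log y`, full form.
[cite: BeatonBousquetMelouDeGierDuminilCopinGuttmann2014, §3.1, Proposition 5 ("log-convex … function of log y", arXiv v5 p. 9); HammersleyTorrieWhittington1982, §2] -/
theorem surfaceMu_rpow_mul_rpow_le (hy₁ : 0 < y₁) (hy₂ : 0 < y₂) (hθ0 : 0 ≤ θ) (hθ1 : θ ≤ 1) :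
    surfaceMu (y₁ ^ θ * y₂ ^ (1 - θ)) ≤ surfaceMu y₁ ^ θ * surfaceMu y₂ ^ (1 - θ) := by
  rcases hθ0.eq_or_lt with rfl | hθ0'
  · simp
  rcases hθ1.eq_or_lt with rfl | hθ1'
  · simp
  have hz : 0 < y₁ ^ θ * y₂ ^ (1 - θ) := mul_pos (Real.rpow_pos_of_pos hy₁ _) (Real.rpow_pos_of_pos hy₂ _)
  refine le_of_tendsto_of_tendsto' (tendsto_hpCoeff_rpow hz)
    (((tendsto_hpCoeff_rpow hy₁).rpow_const (Or.inr hθ0)).mul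
      ((tendsto_hpCoeff_rpow hy₂).rpow_const (Or.inr (sub_nonneg.2 hθ1)))) fun n => ?_
  have h := hpCoeff_rpow_mul_rpow_le hy₁ hy₂ hθ0' hθ1' n
  have h₁ := hpCoeff_nonneg n hy₁.le
  have h₂ := hpCoeff_nonneg n hy₂.le
  calc hpCoeff n (y₁ ^ θ * y₂ ^ (1 - θ)) ^ ((n : ℝ)⁻¹)
      ≤ (hpCoeff n y₁ ^ θ * hpCoeff n y₂ ^ (1 - θ)) ^ ((n : ℝ)⁻¹) :=
        Real.rpow_le_rpow (hpCoeff_nonneg n hz.le) h (inv_nonneg.2 (Nat.cast_nonneg n))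
    _ = (hpCoeff n y₁ ^ ((n : ℝ)⁻¹)) ^ θ * (hpCoeff n y₂ ^ ((n : ℝ)⁻¹)) ^ (1 - θ) := by
        rw [Real.mul_rpow (Real.rpow_nonneg h₁ _) (Real.rpow_nonneg h₂ _), ← Real.rpow_mul h₁, ← Real.rpow_mul h₂,
          mul_comm θ, mul_comm (1 - θ), Real.rpow_mul h₁, Real.rpow_mul h₂]

/-- **Proposition 5 (log-convexity, full statement): `t ↦ log μ(eᵗ)` is convex on `ℝ`.**
[cite: BeatonBousquetMelouDeGierDuminilCopinGuttmann2014, §3.1, Proposition 5 (arXiv v5 p. 9: "It is a log-convex, non-decreasing function of log y"); HammersleyTorrieWhittington1982, §2] -/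
theorem convexOn_log_surfaceMu_exp : ConvexOn ℝ Set.univ (fun t : ℝ => Real.log (surfaceMu (Real.exp t))) := by
  refine convexOn_iff_forall_pos.2 ⟨convex_univ, fun t₁ _ t₂ _ a b ha hb hab => ?_⟩
  obtain rfl : b = 1 - a := by linarith
  simp only [smul_eq_mul]
  have h1 := Real.exp_pos t₁
  have h2 := Real.exp_pos t₂
  have key := surfaceMu_rpow_mul_rpow_le h1 h2 ha.le (by linarith)
  have hexp : Real.exp (a * t₁ + (1 - a) * t₂) = Real.exp t₁ ^ a * Real.exp t₂ ^ (1 - a) := by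
    rw [Real.exp_add, mul_comm a, mul_comm (1 - a), Real.exp_mul, Real.exp_mul]
  rw [hexp]
  calc Real.log (surfaceMu (Real.exp t₁ ^ a * Real.exp t₂ ^ (1 - a)))
      ≤ Real.log (surfaceMu (Real.exp t₁) ^ a * surfaceMu (Real.exp t₂) ^ (1 - a)) :=
        Real.log_le_log (surfaceMu_pos _) key
    _ = a * Real.log (surfaceMu (Real.exp t₁)) + (1 - a) * Real.log (surfaceMu (Real.exp t₂)) := by
        rw [Real.log_mul (Real.rpow_pos_of_pos (surfaceMu_pos _) _).ne' (Real.rpow_pos_of_pos (surfaceMu_pos _) _).ne',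
          Real.log_rpow (surfaceMu_pos _), Real.log_rpow (surfaceMu_pos _)]

/-- **Surface density vanishes in the desorbed phase:** for `0 < y < 1+√2`, `μ` is locally constant, so `μ'(y) = 0`.
[cite: BeatonBousquetMelouDeGierDuminilCopinGuttmann2014, §3.1, remark after Proposition 5 (arXiv v5 p. 9: "the density of vertices on the surface is 0 for y < y_c")] -/
theorem hasDerivAt_surfaceMu_zero (hy0 : 0 < y) (hy : y < 1 + Real.sqrt 2) : HasDerivAt surfaceMu 0 y := by
  refine (hasDerivAt_const y hexConnectiveConstant).congr_of_eventuallyEq ?_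
  filter_upwards [Ioo_mem_nhds hy0 hy] with z hz
  exact (surfaceMu_eq_iff hz.1).2 hz.2.le

/-- Corollary: `deriv μ y = 0` for `0 < y < 1+√2`. [cite: BeatonBousquetMelouDeGierDuminilCopinGuttmann2014, §3.1, remark after Proposition 5 (arXiv v5 p. 9)] -/
theorem deriv_surfaceMu_eq_zero (hy0 : 0 < y) (hy : y < 1 + Real.sqrt 2) : deriv surfaceMu y = 0 :=
  (hasDerivAt_surfaceMu_zero hy0 hy).deriv

/-- **Surface density is positive in the adsorbed phase:** if `y > 1+√2` and `μ` is differentiable at `y` (true for a.e. `y`,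
`ae_differentiableAt_surfaceMu`), then `μ'(y) > 0`, i.e. `y μ'(y)/μ(y) > 0`.  Proof: `G = log μ ∘ exp` is convex
(`convexOn_log_surfaceMu_exp`), `G(log y) > G(log y_c)` since `μ(y) > μ = μ(y_c)`, and the secant slope is at most `G'(log y) = y μ'(y)/μ(y)`.
[cite: BeatonBousquetMelouDeGierDuminilCopinGuttmann2014, §3.1, remark after Proposition 5 (arXiv v5 p. 9: "… and is positive for y > y_c")] -/
theorem deriv_surfaceMu_pos (hy : 1 + Real.sqrt 2 < y) (hd : DifferentiableAt ℝ surfaceMu y) : 0 < deriv surfaceMu y := by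
  have hyc : 0 < 1 + Real.sqrt 2 := by positivity
  have hy0 : 0 < y := hyc.trans hy
  have ht : Real.log (1 + Real.sqrt 2) < Real.log y := Real.log_lt_log hyc hy
  have hd' : HasDerivAt surfaceMu (deriv surfaceMu y) (Real.exp (Real.log y)) := by
    rw [Real.exp_log hy0]; exact hd.hasDerivAt
  have hG : HasDerivAt (fun t : ℝ => Real.log (surfaceMu (Real.exp t)))
      (deriv surfaceMu y * Real.exp (Real.log y) / surfaceMu (Real.exp (Real.log y))) (Real.log y) :=
    (hd'.comp (Real.log y) (Real.hasDerivAt_exp _)).log (surfaceMu_pos _).ne'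
  have hslope := convexOn_log_surfaceMu_exp.slope_le_of_hasDerivAt (Set.mem_univ _) (Set.mem_univ _) ht hG
  have hpos : 0 < slope (fun t : ℝ => Real.log (surfaceMu (Real.exp t))) (Real.log (1 + Real.sqrt 2)) (Real.log y) := by
    rw [slope_def_field]
    refine div_pos (sub_pos.2 ?_) (sub_pos.2 ht)
    rw [Real.exp_log hy0, Real.exp_log hyc]
    refine Real.log_lt_log (surfaceMu_pos _) ?_
    rw [(surfaceMu_eq_iff hyc).2 le_rfl]
    exact (hexConnectiveConstant_lt_surfaceMu_iff hy0).2 hy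
  have h := hpos.trans_le hslope
  rw [Real.exp_log hy0] at h
  have h' : 0 < deriv surfaceMu y * y := (div_pos_iff_of_pos_right (surfaceMu_pos y)).1 h
  exact (mul_pos_iff_of_pos_right hy0).1 h'

/-- The surface density `y μ'(y)/μ(y)` (where `μ'(y)` exists): `0` for `y < 1+√2`, positive for `y > 1+√2`.
[cite: BeatonBousquetMelouDeGierDuminilCopinGuttmann2014, §3.1, remark after Proposition 5 (arXiv v5 p. 9)] -/
theorem surfaceDensity_dichotomy (hy0 : 0 < y) (hd : DifferentiableAt ℝ surfaceMu y) :
    (y < 1 + Real.sqrt 2 → y * deriv surfaceMu y / surfaceMu y = 0) ∧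
    (1 + Real.sqrt 2 < y → 0 < y * deriv surfaceMu y / surfaceMu y) :=
  ⟨fun h => by rw [deriv_surfaceMu_eq_zero hy0 h, mul_zero, zero_div],
   fun h => div_pos (mul_pos hy0 (deriv_surfaceMu_pos h hd)) (surfaceMu_pos y)⟩

end Literature.Probability.RandomPlanarGeometry.SAW.HV
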